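import Literature.AlgebraicGeometry.Shioda1982.ExceptionalQuadruplesComplete
import HarnessLib

/-!
# Shioda 1982 / Meyer–Neutsch 1981: no exceptional quadruple at the level `N = 520` — kernel sweep, part 8 of 16

Topic `Literature/AlgebraicGeometry/Shioda1982`; companion of `ExceptionalQuadruplesComplete.lean` (search `checkB`, soundness
`tabelleOneCompleteAt_of_chunks`, invariant form `exists_mem_reps_of_isExceptionalQuadruple`, statement `TabelleOneCompleteAt`; sources,
method and framing in its module docstring) and of the series `ExceptionalQuadruplesSweep*.lean` (together: every level `2 ≤ N ≤ 180`
that is not a row of Tabelle 1; `…SweepTwoHundredTwenty/…TwoHundredSixty/…ThreeHundredForty.lean`,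
`…SweepTwoHundredFiftyTwo/…ThreeHundredNinetySix/…FourHundredSixtyEight.lean`, `…SweepTwoHundred.lean`: the levels `220, 260, 340`, `252, 396, 468`
and `200` of the families `20p`, `36p`, `40p`). THEOREMS only (no definition, no named fact): the same kernel
search at the single level `N = 520`, which carries NO row of [MeyerNeutsch1981Fermatquadrupel, Tabelle 1] (computer-generated there,
"alle Fermatquadrupel für N ≤ 614 ermittelt", §2 p. 53) and lies above the range `N ≤ 180` of Shioda's table p. 727 — by Aoki's
Theorem C ([Aoki1983], computer-assisted for `181 ≤ m ≤ 672`) there is no exceptional element at any level `> 180`; the files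
`ExceptionalQuadruplesSweepFiveHundredTwentyPartOne.lean`, `ExceptionalQuadruplesSweepFiveHundredTwentyPartTwo.lean`, `ExceptionalQuadruplesSweepFiveHundredTwentyPartThree.lean`, `ExceptionalQuadruplesSweepFiveHundredTwentyPartFour.lean`, `ExceptionalQuadruplesSweepFiveHundredTwentyPartFive.lean`, `ExceptionalQuadruplesSweepFiveHundredTwentyPartSix.lean`, `ExceptionalQuadruplesSweepFiveHundredTwentyPartSeven.lean`, `ExceptionalQuadruplesSweepFiveHundredTwentyPartEight.lean`, `ExceptionalQuadruplesSweepFiveHundredTwentyPartNine.lean`, `ExceptionalQuadruplesSweepFiveHundredTwentyPartTen.lean`, `ExceptionalQuadruplesSweepFiveHundredTwentyPartEleven.lean`, `ExceptionalQuadruplesSweepFiveHundredTwentyPartTwelve.lean`, `ExceptionalQuadruplesSweepFiveHundredTwentyPartThirteen.lean`, `ExceptionalQuadruplesSweepFiveHundredTwentyPartFourteen.lean`, `ExceptionalQuadruplesSweepFiveHundredTwentyPartFifteen.lean`, `ExceptionalQuadruplesSweepFiveHundredTwenty.lean` make the instance `N = 520` a kernel statement. The search at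
`N = 520` visits 3939621 candidate triples (`φ(520) − 1 = 191` units each), too many for one elaboration of bounded wall time, so the
chunks of first entries are spread over 16 files: `ExceptionalQuadruplesSweepFiveHundredTwentyPartOne.lean` — first entries `0 ≤ a < 10` (229016 candidates);
`ExceptionalQuadruplesSweepFiveHundredTwentyPartTwo.lean` — first entries `10 ≤ a < 21` (259961 candidates);
`ExceptionalQuadruplesSweepFiveHundredTwentyPartThree.lean` — first entries `21 ≤ a < 31` (241651 candidates);
`ExceptionalQuadruplesSweepFiveHundredTwentyPartFour.lean` — first entries `31 ≤ a < 41` (244826 candidates);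
`ExceptionalQuadruplesSweepFiveHundredTwentyPartFive.lean` — first entries `41 ≤ a < 51` (246168 candidates);
`ExceptionalQuadruplesSweepFiveHundredTwentyPartSix.lean` — first entries `51 ≤ a < 61` (245676 candidates);
`ExceptionalQuadruplesSweepFiveHundredTwentyPartSeven.lean` — first entries `61 ≤ a < 71` (243351 candidates);
`ExceptionalQuadruplesSweepFiveHundredTwentyPartEight.lean` — first entries `71 ≤ a < 81` (239193 candidates);
`ExceptionalQuadruplesSweepFiveHundredTwentyPartNine.lean` — first entries `81 ≤ a < 92` (256121 candidates);
`ExceptionalQuadruplesSweepFiveHundredTwentyPartTen.lean` — first entries `92 ≤ a < 103` (246431 candidates);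
`ExceptionalQuadruplesSweepFiveHundredTwentyPartEleven.lean` — first entries `103 ≤ a < 115` (254915 candidates);
`ExceptionalQuadruplesSweepFiveHundredTwentyPartTwelve.lean` — first entries `115 ≤ a < 127` (237311 candidates);
`ExceptionalQuadruplesSweepFiveHundredTwentyPartThirteen.lean` — first entries `127 ≤ a < 141` (250387 candidates);
`ExceptionalQuadruplesSweepFiveHundredTwentyPartFourteen.lean` — first entries `141 ≤ a < 157` (245083 candidates);
`ExceptionalQuadruplesSweepFiveHundredTwentyPartFifteen.lean` — first entries `157 ≤ a < 179` (252237 candidates);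
`ExceptionalQuadruplesSweepFiveHundredTwenty.lean` — first entries `179 ≤ a < 520` (247294 candidates); the last one assembles
`completeAt_fiveHundredTwenty` (every sorted pair-free primitive Hodge 4-multiset mod `520` is standard) and `not_isExceptionalQuadruple_fiveHundredTwenty`.
WHY THIS LEVEL (cell `pub-hfermat`): `520 = 40·13`, the instance `p = 13` of the family `m = 40p` of
`HodgeQuadruplesFortyPrime.lean` (`classify_hodgeMultiset_fortyPrime`, `p ≥ 19`) below its range — a residual prime of the
companion `PicardNumberFortyPrime.lean` (`exceptional_fortyPrime`). `decide +kernel` only (no `native_decide`).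

HONEST FRAMING (cell `pub-hfermat`): explicit algebraic cycles for specific Hodge classes on Fermat/Delsarte varieties; residual open
instances listed; no claim on general Hodge. These classes are algebraic (Lefschetz (1,1)); certified here is only the emptiness of the
exceptional list at this level.

## References
* [MeyerNeutsch1981Fermatquadrupel] W. Meyer, W. Neutsch, *Fermatquadrupel*, Math. Ann. 256 (1981) 51–62, §2 p. 53, Tabelle 1 p. 54 (no row 520).
* [Shioda1982PicardFermat] T. Shioda, J. Fac. Sci. Univ. Tokyo IA 28 (1982) 725–734, table p. 727 (levels `≤ 180`), Prop. 4 (Q′) p. 729.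
* [Aoki1983] N. Aoki, Math. Ann. 266 (1983) 23–54, Thm. C.
-/

namespace Literature.AlgebraicGeometry.Shioda1982

open Literature.AlgebraicGeometry.HodgeTheory

set_option maxHeartbeats 0 in
/-- **The search at `N = 520` passes on the first entries `71 ≤ a < 81`** (part 8 of 16: 10 chunks, 239193 candidate
triples): every visited sorted quadruple of representatives there fails the Hodge test or is standard (`checkB`; `reps 520 = []`).
[cite: MeyerNeutsch1981Fermatquadrupel, §2 p. 53 ("alle Fermatquadrupel für N ≤ 614 ermittelt") and Tabelle 1 p. 54 (no row 520)]
[cite: Aoki1983, Thm. C] -/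
theorem checkB_fiveHundredTwenty_partEight :
    ∀ p ∈ ([(71, 1), (72, 1), (73, 1), (74, 1), (75, 1), (76, 1), (77, 1), (78, 1), (79, 1), (80, 1)] : List (ℕ × ℕ)), checkB 520 p.1 p.2 = true := by
  intro p hp
  simp only [List.mem_cons, List.not_mem_nil, or_false] at hp
  rcases hp with rfl | rfl | rfl | rfl | rfl | rfl | rfl | rfl | rfl | rfl <;> decide +kernel

end Literature.AlgebraicGeometry.Shioda1982
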